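import Mathlib
import Literature.MathematicalPhysics.QuantumFieldTheory.Balaban1983to89.B14Thm2
import Literature.MathematicalPhysics.QuantumFieldTheory.Balaban1983to89.B16

/-!
# `Balaban1983to89.B14.RelBoundary` — [Balaban1988Convergent] (2.40)–(2.42), (2.47)–(2.48) pp. 261–264 under the
ALTERNATIVE inductive hypothesis for the boundary terms (p. 262: *"(2.42) with d_j(X) replaced by d_j(X∖Z_j)"*),
i.e. the form [Balaban1989LargeFieldII] (1.99) p. 390 actually delivers: the bound (2.48) KERNEL-CHECKED from
RING ANCHORING (finite sums), and the crossing-free reading of the relative size REFUTED as a consumable hypothesis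

CITATION HEADER (lean-in-tree rule 2026-08-18).  Sources: T. Bałaban, *Convergent renormalization expansions for
lattice gauge theories*, Commun. Math. Phys. **119**, 243–285 (1988) [Balaban1988Convergent] (cell paper B14 = [III];
held `paper:balaban1988-cmp119-convergent-renormalization`, journal page = PDF page + 242); T. Bałaban, *Large field
renormalization. II. Localization, exponentiation, and bounds for the 𝐑 operation*, Commun. Math. Phys. **122**,
355–392 (1989) [Balaban1989LargeFieldII] (cell paper B16; held `paper:balaban1989-cmp122-large-field-ii`, journal page =
PDF page + 354).  Quotations were read on the page renders (cell folder `b2b-balaban-ref1/pages/…`).  Both papers are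
manuscripts UNDER ADJUDICATION by the audit cell `pub-balaban`: nothing printed in them is asserted here.  Every
`theorem` below is finite combinatorics of sums or real arithmetic, proved without `sorry` and without new axioms; the
printed bounds enter only as hypotheses, and the ONE non-elementary input of the re-derivation (the relative anchored
tree-graph bound, `RelAnchoredBound`) is an explicit named hypothesis, never asserted.  NEW satellite module of unit
`b2b-balaban-b01` (gen 2; cell item GAPS.md G-B16-10 (B), the b01/b02 "joint item", consumer side); it imports and does
not modify `…B14Thm2` (unit pv01: `Ineq247`, `bound248_of_247`) and `…B16` (unit b02: `RelDomainSys`, `Ineq199`,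
`relDecay_not_fullDecay`).

WHAT IS PRINTED.  [III] p. 261 [19]: *"(2.41) 𝐁^{(j)}(U_k, A, {S_i}) = Σ_X 𝐁^{(j)}(X, U_k, A, {S_i∩X}), where the sum
is over domains X ∈ 𝐃_j such, that X∩Ω_j ≠ ∅, and X∩Z_j^~ ≠ ∅ … (iv) it satisfies the bound (2.42)
|𝐁^{(j)}(X,(𝐔,𝐉),A,{S_i∩X})| < B₀ exp(−κ d_j(X))"*, with (2.3) p. 255 *"Z_j = Λ_j^c"*, (2.2) *"Γ_j = Ω_j^{(j)}∖Ω_{j+1}^{(j)},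
j = 1,…,k−1, Γ_k = Ω_k^{(k)}"*, p. 256 *"The domains Ω_j, Λ_j … are unions of MR_j-cubes in the lattice T_{L^{−j}}.
They satisfy also other conditions, e.g., the distance between their boundaries is at least equal to 2MR_j"*, p. 259
*"Λ_j^0 the set which is obtained by removing one layer of the MR_j-cubes from Λ_j^{(j)}"*.  p. 262 [20], second paragraph (quoted WHOLE):
*"There are other possible forms of the inductive assumptions for the boundary terms. For example, we may resum all the
terms with localization domains intersecting a given component of the large field region. This gives sum (2.41), with
the summation over domains X ∈ 𝐃_j such that X either contains a component of the large field region Z_j, or is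
disjoint with it. Resumming we lose a part of the exponential factor in (2.42), connected with the region Z_j; hence for
the new terms we obtain the bound (2.42) with d_j(X) replaced by d_j(X∖Z_j). All constructions and proofs of the
procedure can be carried on with these inductive assumptions. We have chosen the ones above, because they agree with
the assumptions for 𝐄-terms and 𝐑-terms."* (closing sentence: the alternative is printed AND DECLINED by [III]; it is
the form [Balaban1989LargeFieldII] (1.99) delivers — cell GAPS G-ref1-9).  pp. 263–264 [21–22]: *"Bounds for the boundary terms
(2.40) are even more elementary. We use the exponential factor exp(−(κ−1)d_j(X)) from the inequality (2.42) to control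
the sum over X in (2.41). The remaining factor exp(−d_j(X)) is used to get an additional small factor, e.g. for j > n it
can be bounded by 2^{−(j−1−n)}. Thus we obtain |𝐁^{(j,n)}| ≤ B₁2^{−(j−n)}|Γ_n| (2.47) … Summing over j from n to k, and
then over n from 1 to k, we get |(2.40)| ≤ 2B₁(Σ_{n=1}^{k−1}|Γ_n| + |Γ_k∖Λ_k^0|) ≤ 2B₁Σ_{n=1}^{k}|Γ_n| (2.48)"*
(*"|Γ_n∩Ω| means the number of points in the set Γ_n∩Ω ⊂ T_1^{(n)}"*, p. 263).  B16 p. 376 [22] (1.67): *"d_{k,Z}(Y)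
[is] M^{−1}(the length of a shortest tree graph contained in Y and intersecting all M-cubes of the components of
Y∖Z)"*; p. 390 [36] (1.99): *"|𝐑′^{(k)}(X,(𝐔,𝐉))| ≤ O(1)c₁exp(−(1+½β)κ d_{k,∪Y_i}(X))"*, c₁ = α^{1/3} for X meeting
the large-field set — these X give the new boundary terms 𝐁′^{(k)} (unit b02, `B16.Ineq199`).

WHAT THIS FILE TYPES AND PROVES (cell GAPS.md C-b01-J1, G-b01-J2, G-b01-J3).
* Part A (generic finite sums): `sum_le_sum_anchored` — a sum of nonnegative terms over an index set `adm`, each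
  index carrying an ANCHOR in a finite set `ring` and lying in the designed fibre `above (anchor X)`, is at most the
  sum over `c ∈ ring` of the fibre sums; `ringBound` — hence termwise bounds `‖B X‖ ≤ B₀·w X` and fibre bounds
  `Σ_{X ∈ above c} w X ≤ K` give `‖Σ_{X∈adm} B X‖ ≤ B₀·K·#ring`.  This is the printed mechanism of (2.48) with the
  anchors placed in the RING `Ω_j∖Λ_j^0` instead of the lowest layer `Γ_n` reached (the decomposition `𝐁^{(j,n)}` of
  (2.47) is then the diagonal one, `n = j`): under (2.3) every admissible X of (2.41) — in the printed OR in the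
  resummed form of p. 262 — has such an anchor (cell GAPS C-b01-J1, hypotheses H1–H2), so no factor `2^{−(j−1−n)}`
  has to be extracted from `exp(−d_j(X))` (which the relative size cannot supply, and which the printed geometry does
  not supply either: `shellWidths_le`, GAPS G-b01-J3).
* Part B (the carrier): `RingAnchor S` over unit b02's `B16.RelDomainSys` (domains with the full size `d_j` and the
  RELATIVE size `dRel` of (1.67)) = the anchoring data of one scale as LOCATED HYPOTHESES (fields `anchor_mem`,
  `mem_above`); `RelAnchoredBound` = the relative anchored tree-graph bound (hypothesis H4 of C-b01-J1, the relative
  form of the summability used silently in [I] (0.26), cf. `B12.scale_sum_le`'s `hK`) — a `def … : Prop`, never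
  asserted; `scaleBound_of_relDecay` — the per-scale bound `‖𝐁^{(j)}‖ ≤ B₀·K·#ring_j` from termwise RELATIVE decay;
  `newBoundary_scaleBound_of_ineq199` — the same for the new boundary terms exactly as b02 typed (1.99)
  (`B16.Ineq199`, second clause), constant `O(1)α^{1/3}·K`.
* Part C (assembly into [III] (2.47)–(2.48) as typed by unit pv01): `diag` (the diagonal decomposition
  `𝐁^{(j,n)} := δ_{nj}𝐁^{(j)}`), `ineq247_of_ringBounds` (per-scale ring bounds ⇒ `B14Thm2.Ineq247` for `diag`),
  `total_eq_sum_diag`, `bound248_of_ringBounds` ((2.48) through `B14Thm2.bound248_of_247`), `bound248_sharp` (the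
  factor 2 of (2.48) is not needed on this route).
* Part D (NEGATIVE, GAPS G-b01-J2): if the relative size did NOT charge the tree length spent crossing a glued
  large-field component ("crossing-free" reading), the hypothesis would not be consumable by ANY volume-linear bound:
  the family `X_S = C′ ∪ S`, `S ⊆` a set of `s` small-field cubes adjacent to one component `C′`, has relative size 0
  termwise, so the termwise hypothesis allows every `|𝐁(X_S)| = B₀`, and `Σ_S B₀ = B₀2^s` exceeds `B₁·(c·s)` for every
  `B₁, c` (`crossingFree_family_sum`, `crossingFree_not_volumeBounded`).  With (1.67) as printed ("contained in Y")
  the crossing IS charged and Part B applies; the dichotomy is recorded producer-side (G-B16-05).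
* Part E (GAPS G-b01-J3, the scale direction in (2.47)): `shellWidths_le` — `Σ_{i<N} i·q^i ≤ q/(1−q)²` for
  `0 ≤ q < 1`: with `q = L^{−1}` the total `d_j`-width of ALL lower-scale collars `Ω_m∖Λ_m`, `m < j` (each
  `2R_m L^{m−j} ≤ 2(L+1)(j−m)^{β₀}R_j L^{m−j}` by (2.9), scale-m lengths being `L^{m−j}` times scale-j lengths, p. 261 (ii)
  before (2.38): *"of the size CML^nξ, or □ ⊂ Ω_j and of the size CM"*, ξ = L^{−j}) is bounded by `2(L+1)R_j·L(L−1)^{−2}` UNIFORMLY in the number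
  of shells crossed — so `exp(−d_j(X)) ≤ 2^{−(j−1−n)}` does not follow from shell crossing for `j − n` large (it was
  asserted with the inverted factor `L^{j−m}` in cell row G-r2.15 (ii)(α)); (2.48) is unaffected (Part C).

NOT TYPED HERE: the cube geometry behind H1–H2 (existence of the anchors) and H4 (the tree-graph bound) — DIVERGENCE F5
(geometry abstracted, as in `B12.CubeCover`); the bounds (2.42)/(1.99) themselves; the 𝐓-step consumption of the old
boundary terms (B16 (1.66), [III] §3), adjudicated at exponent-bookkeeping level in GAPS C-b01-J1 (scope clause).
Value = typed skeleton + census + precise gaps, NOT summit progress.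
-/

open Finset

namespace Literature.MathematicalPhysics.QuantumFieldTheory.Balaban1983to89.B14.RelBoundary

/-! ## Part A. Anchored regrouping of a finite sum (the mechanism of (2.47)–(2.48), anchors as data) -/

/-- ANCHORED REGROUPING ([III] p. 263 bottom: *"We use the exponential factor … to control the sum over X in (2.41)"*,
made explicit): if every index `X ∈ adm` carries an anchor `anchor X ∈ ring` and lies in the designed fibre
`above (anchor X)`, then for nonnegative `f`, `Σ_{X∈adm} f X ≤ Σ_{c∈ring} Σ_{X∈above c} f X`.  Finite combinatorics
(fibrewise summation + monotonicity under enlarging the fibres). [folklore] -/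
theorem sum_le_sum_anchored {ι C : Type*} [DecidableEq C] (adm : Finset ι) (ring : Finset C)
    (above : C → Finset ι) (anchor : ι → C) (f : ι → ℝ) (hf : ∀ X, 0 ≤ f X)
    (hmem : ∀ X ∈ adm, anchor X ∈ ring) (habove : ∀ X ∈ adm, X ∈ above (anchor X)) :
    ∑ X ∈ adm, f X ≤ ∑ c ∈ ring, ∑ X ∈ above c, f X := by
  classical
  rw [← Finset.sum_fiberwise_of_maps_to (s := adm) (t := ring) (g := anchor) hmem f]
  refine Finset.sum_le_sum fun c _ => ?_
  refine Finset.sum_le_sum_of_subset_of_nonneg (fun X hX => ?_) (fun X _ _ => hf X)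
  rw [Finset.mem_filter] at hX
  rw [← hX.2]
  exact habove X hX.1

/-- PER-SCALE RING BOUND (the shape of (2.47) with `n = j`): termwise `‖B X‖ ≤ B₀·w X` on `adm` (the printed (2.42),
or its relative form, at one configuration), anchors in `ring`, and the fibre bounds `Σ_{X∈above c} w X ≤ K` (the
anchored tree-graph summability) give `‖Σ_{X∈adm} B X‖ ≤ B₀·K·#ring`.  Finite sums. [folklore] -/
theorem ringBound {ι C : Type*} [DecidableEq C] {E : Type*} [SeminormedAddCommGroup E]
    (adm : Finset ι) (ring : Finset C) (above : C → Finset ι) (anchor : ι → C)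
    (B : ι → E) (w : ι → ℝ) (B₀ K : ℝ) (hB₀ : 0 ≤ B₀) (hw : ∀ X, 0 ≤ w X)
    (hterm : ∀ X ∈ adm, ‖B X‖ ≤ B₀ * w X)
    (hmem : ∀ X ∈ adm, anchor X ∈ ring) (habove : ∀ X ∈ adm, X ∈ above (anchor X))
    (hK : ∀ c ∈ ring, ∑ X ∈ above c, w X ≤ K) :
    ‖∑ X ∈ adm, B X‖ ≤ B₀ * K * ring.card := by
  calc ‖∑ X ∈ adm, B X‖ ≤ ∑ X ∈ adm, ‖B X‖ := norm_sum_le _ _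
    _ ≤ ∑ X ∈ adm, B₀ * w X := Finset.sum_le_sum hterm
    _ = B₀ * ∑ X ∈ adm, w X := (Finset.mul_sum _ _ _).symm
    _ ≤ B₀ * ∑ c ∈ ring, ∑ X ∈ above c, w X :=
        mul_le_mul_of_nonneg_left (sum_le_sum_anchored adm ring above anchor w hw hmem habove) hB₀
    _ ≤ B₀ * ∑ _c ∈ ring, K := mul_le_mul_of_nonneg_left (Finset.sum_le_sum hK) hB₀
    _ = B₀ * K * ring.card := by rw [Finset.sum_const, nsmul_eq_mul]; ring

/-! ## Part B. The carrier: ring-anchoring data of one scale over `B16.RelDomainSys`; the relative tree-graph bound -/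

/-- RING-ANCHORING DATA of one scale `j` for the resummed boundary sum (2.41)' of [III] p. 262 (domains `X ∈ 𝐃_j`,
connected, `X ∩ Ω_j ≠ ∅`, `X ∩ Z_j^~ ≠ ∅`, `X` containing every component of `Z_j = Λ_j^c` it meets), over unit b02's
carrier `B16.RelDomainSys` (full size `dj`, relative size `dRel` of (1.67)).  The fields are the LOCATED GEOMETRIC
FACTS of cell GAPS C-b01-J1, carried as hypotheses (cube geometry abstracted, DIVERGENCE F5): `ring` = the M-cubes of
`Ω_j∖Λ_j^0` (⊂ Γ_j for j < k by the margin *"the distance between their boundaries is at least equal to 2MR_j"*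
p. 256 applied to the pair (Λ_j, Ω_{j+1}) — H1; = Γ_k∖Λ_k^0 for j = k by (2.2)); `anchor X` = for a PURE domain (X =
one component of Z_j meeting Ω_j) a cube of `X ∩ (Ω_j∖Λ_j)`, for the others a cube of the small-field part
`S(X) = X∖Z_j ⊂ Λ_j` lying in the first M-layer of Λ_j (it exists: X is connected and meets `Z_j^~` — H2);
`above c` = `{the pure domain anchored at c}` for `c ∈ Ω_j∖Λ_j`, `{X : c ∈ S(X)}` for `c ∈ Λ_j∖Λ_j^0`.
[cite: Balaban1988Convergent, (2.41) p.261, p.262 ll.6-15] -/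
structure RingAnchor (S : B16.RelDomainSys) where
  /-- the M-cubes of `π_j` (only those of the ring are used) -/
  Cube : Type
  /-- the index set of (2.41)': admissible domains at scale `j` -/
  adm : Finset S.Dom
  /-- the M-cubes of the ring `Ω_j ∖ Λ_j^0` -/
  ring : Finset Cube
  /-- the designed fibres `above c` (pure domain anchored at `c`, or the domains whose small-field part contains `c`) -/
  above : Cube → Finset S.Dom
  /-- the anchor map -/
  anchor : S.Dom → Cube
  /-- H1–H2: every admissible domain is anchored in the ring -/
  anchor_mem : ∀ X ∈ adm, anchor X ∈ ring
  /-- every admissible domain lies in the fibre of its anchor -/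
  mem_above : ∀ X ∈ adm, X ∈ above (anchor X)

/-- H4 of cell GAPS C-b01-J1 — the RELATIVE ANCHORED TREE-GRAPH BOUND at rate `κ` with constant `K`: for every ring cube
`c`, `Σ_{X ∈ above c} exp(−κ·dRel X) ≤ K`.  For `c ∈ Ω_j∖Λ_j` the fibre has at most one (pure) element and the bound
holds with `K ≥ 1`; for `c ∈ Λ_j∖Λ_j^0` it is the relative form of the lattice-animal summability `Σ_{X ⊃ □}
exp(−κ d_j(X)) ≤ O(1)` used silently in [I] (0.26) (`B12.scale_sum_le`, hypothesis `hK`): with (1.67) as printed (the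
tree is CONTAINED in X, so crossing a glued component is charged by its length) it holds for `κ ≥ κ_d` uniformly in
`Z_j` — the optimal tree of length `M·D` meets a connected animal `A ∋ c` of at most `c_d(D+1)` cubes containing
`S(X)`, and `X` is determined by `S(X) ⊆ A` together with a subset of the at most `2d·|S(X)|` components of `Z_j`
adjacent to `S(X)`, whence `K ≤ Σ_a (2·4^d·c′_d)^a e^{κ(1 − a/c_d)} < ∞`.  A HYPOTHESIS here (never asserted; geometry
abstracted).  [cite: Balaban1987RG1, (0.26) p.257] -/
def RelAnchoredBound (S : B16.RelDomainSys) (A : RingAnchor S) (κ K : ℝ) : Prop :=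
  ∀ c ∈ A.ring, ∑ X ∈ A.above c, Real.exp (-κ * S.dRel X) ≤ K

/-- THE PER-SCALE BOUND UNDER RELATIVE DECAY (cell GAPS C-b01-J1): if the (resummed) boundary terms of scale `j` satisfy,
at one configuration, *"(2.42) with d_j(X) replaced by d_j(X∖Z_j)"* — `‖B X‖ ≤ B₀ exp(−κ·dRel X)` on the admissible
domains — and the ring-anchoring data with the relative tree-graph bound `K` are given, then
`‖Σ_{X∈adm} B X‖ ≤ B₀·K·#(M-cubes of Ω_j∖Λ_j^0)`; with H1 this is `≤ B₀KM^{−d}|Γ_j|` (j < k), `B₀KM^{−d}|Γ_k∖Λ_k^0|`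
(j = k), i.e. the per-scale input of (2.48) with `B₁ = B₀KM^{−d}` and NO factor `2^{−(j−n)}` needed.  Finite sums over
the hypotheses. [cite: Balaban1988Convergent, (2.47)-(2.48) pp.263-264] -/
theorem scaleBound_of_relDecay (S : B16.RelDomainSys) (A : RingAnchor S) {Φ : Type*} (B : S.Dom → Φ → ℂ)
    (φ : S.Dom → Φ) (B₀ κ K : ℝ) (hB₀ : 0 ≤ B₀)
    (hterm : ∀ X ∈ A.adm, ‖B X (φ X)‖ ≤ B₀ * Real.exp (-κ * S.dRel X))
    (hK : RelAnchoredBound S A κ K) :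
    ‖∑ X ∈ A.adm, B X (φ X)‖ ≤ B₀ * K * A.ring.card := by
  classical
  exact ringBound A.adm A.ring A.above A.anchor (fun X => B X (φ X)) (fun X => Real.exp (-κ * S.dRel X)) B₀ K hB₀
    (fun _ => Real.exp_nonneg _) hterm A.anchor_mem A.mem_above hK

/-- THE SAME FOR THE NEW BOUNDARY TERMS EXACTLY AS B16 DELIVERS THEM (unit b02's `B16.Ineq199`, second clause: for X
meeting the large-field set, `‖𝐑′^{(k)}(X,φ)‖ ≤ O(1)·α^{1/3}·exp(−(1+½β)κ·d_{k,∪Y_i}(X))` on `Ũ^c_k(X,α̃₀,α̃₁)`): if the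
admissible domains of the anchoring data all meet the large-field set and the configuration restricted to each X lies
in its analyticity domain, then `‖Σ_{X∈adm} 𝐑′^{(k)}(X,φ)‖ ≤ O(1)α^{1/3}·K·#ring_k` with `K` the relative tree-graph
constant at rate `(1+½β)κ` — the scale-k instance of the (2.48) input, constant `B₁^{new} = O(1)α^{1/3}KM^{−d}`.
Bookkeeping over b02's typed (1.99); nothing of B16 is asserted. [cite: Balaban1989LargeFieldII, (1.99) p.390] -/
theorem newBoundary_scaleBound_of_ineq199 (S : B16.RelDomainSys) (A : RingAnchor S) {Φ : Type*}
    (dom : S.Dom → Set Φ) (R' : S.Dom → Φ → ℂ) (C p0val α β κ K : ℝ) (hC : 0 ≤ C) (hα : 0 ≤ α)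
    (h199 : B16.Ineq199 S dom R' C p0val α β κ)
    (hadm : ∀ X ∈ A.adm, S.MeetsLF X) (φ : S.Dom → Φ) (hφ : ∀ X ∈ A.adm, φ X ∈ dom X)
    (hK : RelAnchoredBound S A ((1 + β / 2) * κ) K) :
    ‖∑ X ∈ A.adm, R' X (φ X)‖ ≤ C * α ^ (1 / 3 : ℝ) * K * A.ring.card := by
  have hB₀ : 0 ≤ C * α ^ (1 / 3 : ℝ) := mul_nonneg hC (Real.rpow_nonneg hα _)
  exact scaleBound_of_relDecay S A R' φ (C * α ^ (1 / 3 : ℝ)) ((1 + β / 2) * κ) K hB₀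
    (fun X hX => h199.2 X (hadm X hX) (φ X) (hφ X hX)) hK

/-! ## Part C. Assembly into (2.47)–(2.48) of [III] as typed by unit pv01 (`B14Thm2.Ineq247`, `bound248_of_247`) -/

/-- The DIAGONAL decomposition of (2.40): `𝐁^{(j,n)} := 𝐁^{(j)}` if `n = j`, `0` otherwise (every admissible domain is
anchored at its own scale's ring, Part B; the symbol `𝐁^{(j,n)}` is not defined in [III] — GAPS G-pv01-1 (i)).
[cite: Balaban1988Convergent, (2.47) p.264] -/
def diag (Bs : ℕ → ℝ) : ℕ → ℕ → ℝ := fun j n => if n = j then Bs j else 0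

/-- Per-scale ring bounds `|𝐁^{(j)}| ≤ B₁·V_j` (`1 ≤ j ≤ k`; `V_j` = the printed volume, `|Γ_j|` resp. `|Γ_k∖Λ_k^0|`)
give pv01's typed (2.47) `B14Thm2.Ineq247` for the diagonal decomposition (the factor `2^{−(j−n)}` is `1` on the
diagonal and multiplies `0` off it).  Real arithmetic. [cite: Balaban1988Convergent, (2.47) p.264] -/
theorem ineq247_of_ringBounds (k : ℕ) (Bs V : ℕ → ℝ) (B₁ : ℝ) (hB : 0 ≤ B₁)
    (hV : ∀ n, 1 ≤ n → n ≤ k → 0 ≤ V n) (h : ∀ j, 1 ≤ j → j ≤ k → |Bs j| ≤ B₁ * V j) :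
    B14Thm2.Ineq247 (diag Bs) B₁ V k := by
  intro n j hn hnj hjk
  unfold diag
  by_cases hnj' : n = j
  · subst hnj'
    rw [if_pos rfl, sub_self, neg_zero, Real.rpow_zero, mul_one]
    exact h n hn hjk
  · rw [if_neg hnj', abs_zero]
    exact mul_nonneg (mul_nonneg hB (Real.rpow_nonneg (by norm_num) _)) (hV n hn (hnj.trans hjk))

/-- The double sum of pv01's (2.48) over the diagonal decomposition is the plain sum (2.40) `Σ_{j=1}^{k} 𝐁^{(j)}`.
Finite sums. [folklore] -/
theorem total_eq_sum_diag (k : ℕ) (Bs : ℕ → ℝ) :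
    ∑ n ∈ Finset.Icc 1 k, ∑ j ∈ Finset.Icc n k, diag Bs j n = ∑ j ∈ Finset.Icc 1 k, Bs j := by
  refine Finset.sum_congr rfl fun n hn => ?_
  rw [Finset.mem_Icc] at hn
  unfold diag
  rw [Finset.sum_ite_eq, if_pos (Finset.mem_Icc.mpr ⟨le_rfl, hn.2⟩)]

/-- **(2.48) UNDER THE RELATIVE HYPOTHESIS** (cell GAPS C-b01-J1): per-scale ring bounds `|𝐁^{(j)}| ≤ B₁V_j` with
`0 ≤ V_j ≤ |Γ_j|` give the printed (2.48) `|(2.40)| ≤ 2B₁ΣV_n ≤ 2B₁Σ|Γ_n|` — obtained here THROUGH pv01's kernel theorem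
`B14Thm2.bound248_of_247` applied to the diagonal decomposition, so the downstream chain (2.49)–(2.50)
(`B14Thm2.ineq249_of_perScale`, unit pv06) is fed unchanged. [cite: Balaban1988Convergent, (2.48) p.264] -/
theorem bound248_of_ringBounds (k : ℕ) (Bs V Γ : ℕ → ℝ) (B₁ : ℝ) (hB : 0 ≤ B₁)
    (hV : ∀ n, 1 ≤ n → n ≤ k → 0 ≤ V n) (hVΓ : ∀ n, 1 ≤ n → n ≤ k → V n ≤ Γ n)
    (h : ∀ j, 1 ≤ j → j ≤ k → |Bs j| ≤ B₁ * V j) :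
    |∑ j ∈ Finset.Icc 1 k, Bs j| ≤ 2 * B₁ * ∑ n ∈ Finset.Icc 1 k, V n ∧
      2 * B₁ * ∑ n ∈ Finset.Icc 1 k, V n ≤ 2 * B₁ * ∑ n ∈ Finset.Icc 1 k, Γ n := by
  have h248 := B14Thm2.bound248_of_247 k (diag Bs) V Γ B₁ hB hV hVΓ (ineq247_of_ringBounds k Bs V B₁ hB hV h)
  rwa [total_eq_sum_diag] at h248

/-- On this route the factor `2` of (2.48) (the dyadic sum `Σ_{j≥n} 2^{−(j−n)} ≤ 2`) is not needed:
`|Σ_j 𝐁^{(j)}| ≤ B₁ Σ_j V_j` directly. Real arithmetic. [folklore] -/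
theorem bound248_sharp (k : ℕ) (Bs V : ℕ → ℝ) (B₁ : ℝ)
    (h : ∀ j, 1 ≤ j → j ≤ k → |Bs j| ≤ B₁ * V j) :
    |∑ j ∈ Finset.Icc 1 k, Bs j| ≤ B₁ * ∑ j ∈ Finset.Icc 1 k, V j := by
  rw [Finset.mul_sum]
  refine (Finset.abs_sum_le_sum_abs _ _).trans (Finset.sum_le_sum fun j hj => ?_)
  rw [Finset.mem_Icc] at hj
  exact h j hj.1 hj.2

/-! ## Part D. NEGATIVE: the crossing-free reading of the relative size is not a consumable hypothesis (GAPS G-b01-J2) -/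

/-- THE CROSSING-FREE FAMILY.  Model: one glued large-field component `C′` and `s` small-field M-cubes ("slots",
indexed by `range s`) adjacent to `C′` and pairwise non-adjacent; for `S ⊆ slots` the domain `X_S = C′ ∪ S` is
connected, contains the component, meets `Ω_j`.  If tree length INSIDE `C′` were not counted, every `X_S` would have
relative size `0` (each slot is touched from `C′`), so the termwise hypothesis "`|𝐁(X_S)| ≤ B₀exp(−κ·0)`" admits the
constant family `𝐁(X_S) = B₀`, whose sum over the `2^s` subsets is `B₀·2^s`.  Finite sums. [folklore] -/
theorem crossingFree_family_sum (B₀ κ : ℝ) (s : ℕ) :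
    ∑ _S ∈ (Finset.range s).powerset, B₀ * Real.exp (-κ * 0) = B₀ * 2 ^ s := by
  rw [Finset.sum_const, Finset.card_powerset, Finset.card_range, nsmul_eq_mul, mul_zero, Real.exp_zero, mul_one]
  push_cast
  ring

/-- … and `B₀·2^s` is NOT bounded by any volume-linear quantity `B₁·(c·s)` (the ring volume available near `C′` grows
linearly with the number of slots): for every `B₁, c` some `s` violates it.  Hence a boundary-term hypothesis with
crossing-FREE relative decay cannot yield (2.47)/(2.48) or any bound linear in `Σ|Γ_n|` — the consumer needs the
crossing CHARGED, which (1.67) as printed ("a shortest tree graph contained in Y") provides (then Part B applies).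
Real arithmetic (`m < 2^m`). [folklore] -/
theorem crossingFree_not_volumeBounded (B₀ : ℝ) (hB₀ : 0 < B₀) (B₁ c κ : ℝ) :
    ∃ s : ℕ, B₁ * (c * s) < ∑ _S ∈ (Finset.range s).powerset, B₀ * Real.exp (-κ * 0) := by
  obtain ⟨m, hm1, hmA⟩ : ∃ m : ℕ, 1 ≤ m ∧ 2 * (B₁ * c) / B₀ ≤ m :=
    ⟨⌈2 * (B₁ * c) / B₀⌉₊ + 1, by omega,
      (Nat.le_ceil _).trans (by exact_mod_cast Nat.le_succ _)⟩
  refine ⟨2 * m, ?_⟩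
  rw [crossingFree_family_sum]
  have hm0 : (0 : ℝ) < m := by exact_mod_cast hm1
  have h2m : (m : ℝ) < 2 ^ m := by exact_mod_cast Nat.lt_two_pow_self
  have hA : 2 * (B₁ * c) ≤ (m : ℝ) * B₀ := (div_le_iff₀ hB₀).mp hmA
  calc B₁ * (c * ((2 * m : ℕ) : ℝ)) = 2 * (B₁ * c) * m := by push_cast; ring
    _ ≤ (m : ℝ) * B₀ * m := mul_le_mul_of_nonneg_right hA hm0.le
    _ = B₀ * ((m : ℝ) * m) := by ring
    _ < B₀ * (2 ^ m * 2 ^ m) := mul_lt_mul_of_pos_left (mul_lt_mul'' h2m h2m hm0.le hm0.le) hB₀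
    _ = B₀ * 2 ^ (2 * m) := by rw [← pow_add, two_mul]

/-- The dichotomy in one line: under the crossing-free reading there is NO constant `B₁` making the per-scale ring
bound `Σ_{X} |𝐁(X)| ≤ B₁·#ring` hold for all admissible families (take `c = 1`: ring volume `s`), whereas under the
charged reading `scaleBound_of_relDecay` gives one. [folklore] -/
theorem crossingFree_no_ringConstant (B₀ : ℝ) (hB₀ : 0 < B₀) (κ : ℝ) :
    ¬ ∃ B₁ : ℝ, ∀ s : ℕ, ∑ _S ∈ (Finset.range s).powerset, B₀ * Real.exp (-κ * 0) ≤ B₁ * s := by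
  rintro ⟨B₁, hB₁⟩
  obtain ⟨s, hs⟩ := crossingFree_not_volumeBounded B₀ hB₀ B₁ 1 κ
  have := hB₁ s
  rw [one_mul] at hs
  linarith

/-! ## Part E. The scale direction in (2.47): total width of the lower-scale collars is bounded (GAPS G-b01-J3) -/

/-- `Σ_{i<N} i·q^i ≤ q/(1−q)²` for `0 ≤ q < 1`, uniformly in `N` (partial sums of a convergent series of nonnegative
terms).  With `q = L^{−1}`: the collar `Ω_m∖Λ_m` of an EARLIER scale `m = j − i` has width `≥ 2MR_m` in scale-m units
(p. 256), i.e. `2R_m·L^{−i}` in `d_j`-units (scale-m lengths are `L^{m−j}` times scale-j lengths: p. 261 (ii) before (2.38)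
*"… of the size CML^nξ, or □ ⊂ Ω_j and of the size CM"*, ξ = L^{−j}, and (2.34) bounds plaquettes on `Ω_n∖Ω_{n+1}` by
`α_{0,n}ξ²(L^nξ)^{−2}`, the scale-n unit being `L^nξ = L^{n−j}`; B16 p. 376 l. 2–4 converts `d_j` to `d_k`, k > j, by the factor
`(L^jη)^{−1} = L^{k−j} ≥ 1` on the `d_k` side), and `R_m ≤ (L+1)(j−m)^{β₀}R_j ≤ (L+1)·i·R_j` by (2.9) (`β₀ ≤ 1`,
`i ≥ 1`); so the sum of the guaranteed widths of ALL collars between `Ω_j` and `Γ_n` is `≤ 2(L+1)R_j·L(L−1)^{−2}`,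
independent of `j − n`: the printed *"exp(−d_j(X)) … for j > n can be bounded by 2^{−(j−1−n)}"* does not follow from
the geometry of §2 once `(j−1−n)·log 2` exceeds that constant (cell row G-r2.15 (ii)(α) had the factor inverted,
`L^{j−m}`).  (2.48) does not need it (Part C).  Real analysis (Mathlib `tsum_coe_mul_geometric_of_norm_lt_one`). [folklore] -/
theorem shellWidths_le (q : ℝ) (hq0 : 0 ≤ q) (hq1 : q < 1) (N : ℕ) :
    ∑ i ∈ Finset.range N, (i : ℝ) * q ^ i ≤ q / (1 - q) ^ 2 := by
  have hnorm : ‖q‖ < 1 := by rwa [Real.norm_eq_abs, abs_of_nonneg hq0]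
  have hs : Summable (fun n : ℕ => (n : ℝ) * q ^ n) := by
    simpa using summable_pow_mul_geometric_of_norm_lt_one 1 hnorm
  rw [← tsum_coe_mul_geometric_of_norm_lt_one hnorm]
  exact hs.sum_le_tsum _ (fun i _ => mul_nonneg (Nat.cast_nonneg _) (pow_nonneg hq0 _))

end Literature.MathematicalPhysics.QuantumFieldTheory.Balaban1983to89.B14.RelBoundary
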